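import Summits.QuantumFields.BalabanUV.Beta.D1BFx.MomentTransferPeriodicEntry

/-!
# `BalabanUV.Beta.D1BFx.MomentTransferKronecker` — roads «BF-x» / «FP» for binder row D1, leaf K-R5 REFINED: THE MATRIX SANDWICH
# `Wᵀ · P · W` WITH A BLOCK-PERIODIC TWO-POINT KERNEL WHEN THE TRANSPORT COLUMN HAS KRONECKER FIRST MOMENTS — the cross terms
# of the nine-term master identity in CLOSED FORM, and the `d = 4` identity `coarse bond second moment = base-point average`
# AT THE ENTRIES `κ, λ ∈ {a, b}` WITHOUT the base-point-summed first-moment hypothesis `hT1`: only its DIAGONAL part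
# (`Σ_t t_c · P c e (b+t) b = 0` — the Ward identity for the QUADRATIC gauge function, i.e. FIRST-BOND DIVERGENCE-FREENESS) and
# the fibre-transposition symmetry of the kernel are used

HONEST DEPENDENCY (page 1, mandatory): continuum YM on T⁴ ⇐ BetaPertH ∧ nine spine estimates (0/9 proved); BetaPertH ⇐ (D1) ∧ (D4) ∧
CAP+tail; G-an2-4 gates asym, D1 and NE2/3/4.  HONEST FRAMING (cell contract, verbatim): «discharging `BetaPertH` makes Bałaban's UV
stability UNCONDITIONAL — a real constructive-QFT result; it is NOT the continuum limit and NOT the Clay problem.»  THIS MODULE DISCHARGES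
NOTHING of D1 / BetaPertH: [folklore] bookkeeping of absolutely convergent lattice sums over `ℝ`, composed BY NAME from leaf K-R5
(`MomentTransferPeriodic` §2 collapses, `MomentTransferPeriodicMaster.hasSum_termP_second`'s nine monomials, `MomentTransferPeriodicSum`'s
majorant engine and `sum_firstMoment_baseKer_eq_zero_of_symm` pattern, `MomentTransferPeriodicEntry`'s matrix packaging) and an2's
`KernelRepresentationSummable.hasSum_zero_of_divFree` (telescoping pattern).  No `def`, no `Prop` mirror, no cited fact, 0 sorry; every
hypothesis on the patterns `w` and the kernel `P` is DISPLAYED; 0 wall binders; NOT hrep, NOT D1, NOT BetaPertH, NOT continuum, NOT Clay.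

ABSOLUTE RULE (cell charter, verbatim): «No internally-minted statement may enter as a cited fact. Every hypothesis is either
kernel-proved in this package or a verbatim quotation of a PUBLISHED theorem with page reference. The manuscript(s) under audit are NOT
citable for their own disputed steps — they are the thing under adjudication; programme-internal (2001/route/tribunal) claims are never
citable.»

WHY (road FP supplier row «hT1-from-reflection», owner d1-p3 R-FP-8 (2); road BF-x leaf A4 / K-R5).  K-R5's END
`MomentTransferPeriodicEntry.bondSecondMomentP_tsum_four` carries `hT1 : ∀ c e μ, Σ_{classes r} Σ'_t t_μ · P c e (r+t) r = 0` — ALL base-point-summed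
first moments of EVERY entry.  Its only supplier in the tree is an inversion / reflection covariance of the full fine kernel
(`MomentTransferParity`, `FP/PerfectFirstMoment`), which the corner-rooted axial projector of record does NOT have (leaf-02-g3's caution,
CLAIMS 2026-08-20T13:55:25Z; an5 `CornerRootInstance.axProj_not_reflectionCovariant`).  beta-num-g36's exact-arithmetic CROSS formula
(CLAIMS 13:48:10Z, (M3)/(M4)) and beta-num-g37's structure note (14:08:28Z, (S)) locate what is really consumed: with KRONECKER masses
`δ_{κl}·σ` AND KRONECKER first moments `δ_{κl}·C⁽κ⁾` of the column (the latter PROVABLE from affine reproduction — `FP/PerfectColumnKronecker`),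
the cross terms of the `(a,b)` entry reduce to `σ·[(C⁽ᵇ⁾−C⁽ᵃ⁾)_λ · m₁[P_{ab}]_κ + (C⁽ᵇ⁾−C⁽ᵃ⁾)_κ · m₁[P_{ab}]_λ]` (§3), so for the entries
`κ, λ ∈ {a, b}` — in particular `(κ, λ) = (a, b)`, EXACTLY `B12Beta.secondMoment`'s shape `Σ_x P_{μν}(x)·x_μ·x_ν` — only `m₁[P_{ab}]_a` and
`m₁[P_{ab}]_b` are needed, and THESE vanish by the quadratic-gauge Ward identity (§5, file `MomentTransferKroneckerWard`: first-bond divergence-freeness, the input that already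
yields `hrow` in `FineHessianWard`) plus the transposition antisymmetry `m₁[P_{ab}] = −m₁[P_{ba}]` (§1, Hessian symmetry).  No reflection,
no rooting.

CONTENT (all [folklore], `d`, `N` general unless stated).
* §1 `sum_firstMoment_baseKer_eq_neg_of_transpose` — two block-periodic kernels with `P s s' = Q s' s`: base-point-summed first moments of `P`
  are MINUS those of `Q` (leaf K-R5's `_of_symm` is `P = Q`).
* §2 `hasSum_termP_second_of_colrow`, `decimatedSumP_second_moment_lattice_of_colrow` — the FIVE-TERM identity: the nine-term master under
  POINTWISE column/row sums zero with the first moments KEPT: `σσ'·ΣM₂ + (σC'_λ − C_λσ')·ΣM₁κ + (σC'_κ − C_κσ')·ΣM₁λ`.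
* §3 `secondMoment_dressedEntryP_hasSum_lattice_kronecker` — the matrix sandwich with Kronecker masses and Kronecker first moments: main term
  `+` the CROSS term above, in closed form.
* §4 `secondMoment_dressedEntryP_hasSum_lattice_of_diag`, `bondSecondMomentP_hasSum_four_of_diag`, **`bondSecondMomentP_tsum_four_of_diag`**
  (`d = 4`, `κ, λ ∈ {a, b}`: the K-R5 identity with `hT1` replaced by its DIAGONAL part + transposition symmetry), `…_of_diag_entry` (`a = b`:
  NO first-moment hypothesis at all).
* (§5, file `MomentTransferKroneckerWard`) the diagonal first moments from FIRST-BOND DIVERGENCE-FREENESS (quadratic-gauge Ward identity by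
  telescoping) and the END `bondSecondMomentP_tsum_four_of_divFree`.
Unit `b2b-balaban-beta-d1-formalise-leaf-02` (gen 4).
-/

namespace Summit.QuantumFields.BalabanUV.Beta.D1BFx.MomentTransferKronecker

open Finset Filter Topology
open Literature.MathematicalPhysics.QuantumFieldTheory.Balaban1983to89
open Literature.MathematicalPhysics.QuantumFieldTheory.Balaban1983to89.Beta
open DecimatedMoment (cosetInd)
open DecimatedMomentSummable (mono IsMoment₂ second_weight_expand ConstReproSum LinReproSum AbsMoment₂ summable_of_absMoment₂
  summable_smul_of_absMoment₂)
open DressedMomentNormalisation (EKer resSite)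
open KernelRepresentationSummable (hasSum_zero_of_divFree)
open MomentTransferPeriodic MomentTransferPeriodicMaster MomentTransferPeriodicSum
open MomentTransferPeriodicEntry (EKer₂ dressedEntryP avgM2)

variable {d N : ℕ}

/-! ## §1 Transposition: base-point-summed first moments are ANTISYMMETRIC under `P s s' ↦ P s' s` -/

/-- [folklore] **(T1-avg) ANTISYMMETRY UNDER TRANSPOSITION.**  `P`, `Q` block periodic with base-point-uniform majorants of absolutely
summable second moment, and `P s s' = Q s' s`: for every `μ`, `Σ_{classes b} Σ'_t t_μ · P (b+t) b = − Σ_{classes b} Σ'_t t_μ · Q (b+t) b`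
(reflect the displacement, transpose, and undo the shift of the residue system by periodicity — the proof of
`MomentTransferPeriodicSum.sum_firstMoment_baseKer_eq_zero_of_symm`, which is the case `P = Q`). -/
theorem sum_firstMoment_baseKer_eq_neg_of_transpose (hN : 0 < N) {P Q : Ker₂ d} (hQ : IsBlockPeriodic N Q)
    (hPQ : ∀ s s', P s s' = Q s' s) {G : (Fin d → ℤ) → ℝ} (hG : AbsMoment₂ G) (hQG : ∀ b t, |Q (b + t) b| ≤ G t) (μ : Fin d) :
    ∑ r : Fin d → Fin N, ∑' t, (t μ : ℝ) * baseKer P (resSite r) t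
      = -∑ r : Fin d → Fin N, ∑' t, (t μ : ℝ) * baseKer Q (resSite r) t := by
  have hsum0 : ∀ b, Summable (fun t => (t μ : ℝ) * baseKer Q b t) := fun b => by
    simpa only [zero_smul, sub_zero] using summable_firstMoment_of_majorant hG hQG μ b 0
  have hsum1 : ∀ b, Summable (fun t => (t μ : ℝ) * baseKer Q (b - t) t) := fun b => by
    simpa only [one_smul] using summable_firstMoment_of_majorant hG hQG μ b 1
  -- transposition + reflection of the displacement, at every base point
  have h1 : ∀ b, ∑' t, (t μ : ℝ) * baseKer P b t = -∑' t, (t μ : ℝ) * baseKer Q (b - t) t := by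
    intro b
    rw [← tsum_neg]
    conv_lhs => rw [← (Equiv.neg (Fin d → ℤ)).tsum_eq]
    refine tsum_congr (fun t => ?_)
    simp only [Equiv.neg_apply, baseKer, Pi.neg_apply, Int.cast_neg, sub_add_cancel]
    rw [← sub_eq_add_neg, hPQ (b - t) b]
    ring
  -- the shifted class sum is the unshifted one
  have h2 : ∑ r : Fin d → Fin N, ∑' t, (t μ : ℝ) * baseKer Q (resSite r - t) t
      = ∑ r : Fin d → Fin N, ∑' t, (t μ : ℝ) * baseKer Q (resSite r) t := by
    rw [← Summable.tsum_finsetSum (fun r _ => hsum1 (resSite r)), ← Summable.tsum_finsetSum (fun r _ => hsum0 (resSite r))]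
    refine tsum_congr (fun t => ?_)
    rw [← Finset.mul_sum, ← Finset.mul_sum,
      sum_resSite_sub_eq hN (m := fun b => baseKer Q b t) (fun b z => by rw [baseKer_add_zsmul hQ]) t]
  calc ∑ r : Fin d → Fin N, ∑' t, (t μ : ℝ) * baseKer P (resSite r) t
      = ∑ r : Fin d → Fin N, -∑' t, (t μ : ℝ) * baseKer Q (resSite r - t) t :=
        Finset.sum_congr rfl (fun r _ => h1 (resSite r))
    _ = -∑ r : Fin d → Fin N, ∑' t, (t μ : ℝ) * baseKer Q (resSite r) t := by rw [Finset.sum_neg_distrib, h2]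

/-! ## §2 The five-term identity: columns and rows of `P` sum to zero pointwise, first moments kept -/

section FiveTerm

variable (w : (Fin d → ℤ) → ℝ) (P : Ker₂ d) (w' : (Fin d → ℤ) → ℝ)

/-- [folklore] **THE FIVE-TERM IDENTITY** (`0 < N`).  The nine-term master identity `MomentTransferPeriodicMaster.hasSum_termP_second` under
«columns AND rows of `P` sum to zero at every point» (`Σ_t P (b+t) b = 0 = Σ_{s'} P b s'`), both patterns reproducing constants (`σ`, `σ'`) and
affine functions (`C`, `C'`) through `N•ℤ^d`, base-point first moments `m₁ μ b`, second moments `m₂ b` — the base-point-summed first moments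
NOT assumed to vanish: the windowed second moment of the dressed sum is
`σσ' · Σ_b m₂ b + (σ·C'λ − Cλ·σ') · Σ_b m₁κ b + (σ·C'κ − Cκ·σ') · Σ_b m₁λ b`. -/
theorem hasSum_termP_second_of_colrow (hN : 0 < N) (hP : IsBlockPeriodic N P) {σ σ' : ℝ} {C C' : Fin d → ℝ}
    (hL0 : ConstReproSum N w σ) (hL1 : LinReproSum N w C) (hR0 : ConstReproSum N w' σ') (hR1 : LinReproSum N w' C')
    (κ l : Fin d) {m₂ : (Fin d → ℤ) → ℝ} {m₁ : Fin d → (Fin d → ℤ) → ℝ}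
    (hcol : ∀ b, HasSum (baseKer P b) 0) (hrow : ∀ b, HasSum (P b) 0)
    (hm1 : ∀ b μ, HasSum (fun t => t μ • baseKer P b t) (m₁ μ b))
    (hm2 : ∀ b, HasSum (fun t => (t κ * t l) • baseKer P b t) (m₂ b)) (hS : MonoSummableP N w P w') :
    HasSum (termP N w P w' (fun u t x => (t + x - u) κ * (t + x - u) l))
      (σ * σ' * ∑ b : Fin d → Fin N, m₂ (resSite b)
        + (σ * C' l - C l * σ') * ∑ b : Fin d → Fin N, m₁ κ (resSite b)
        + (σ * C' κ - C κ * σ') * ∑ b : Fin d → Fin N, m₁ l (resSite b)) := by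
  have hW := DecimatedMomentSummable.hasSum_window_one (cosetInd N) w hL0
  have hW' := DecimatedMomentSummable.hasSum_window_one (cosetInd N) w' hR0
  have h0' : ∀ b, HasSum (fun t => (fun _ => (1 : ℤ)) t • baseKer P b t) 0 :=
    fun b => DecimatedMomentSummable.hasSum_one_smul (hcol b)
  rw [second_weight_expand, termP_add, termP_sub, termP_sub, termP_add, termP_sub, termP_sub, termP_add, termP_add]
  simp only [Pi.add_def, Pi.sub_def]
  have h := ((((((((hasSum_termP_left w P w' hN hP _ hW _ _ hm2 hW' (hS _ _ _ .one (.coord2 κ l) .one)).add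
    (hasSum_termP_left w P w' hN hP _ hW _ _ (fun b => hm1 b κ) (fun a => hR1 a l)
      (hS _ _ _ .one (.coord κ) (.coord l)))).add
    (hasSum_termP_left w P w' hN hP _ hW _ _ (fun b => hm1 b l) (fun a => hR1 a κ)
      (hS _ _ _ .one (.coord l) (.coord κ)))).sub
    (hasSum_termP_left w P w' hN hP _ (fun a => hL1 a l) _ _ (fun b => hm1 b κ) hW'
      (hS _ _ _ (.coord l) (.coord κ) .one))).sub
    (hasSum_termP_left w P w' hN hP _ (fun a => hL1 a κ) _ _ (fun b => hm1 b l) hW'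
      (hS _ _ _ (.coord κ) (.coord l) .one))).add
    (hasSum_termP_left_of_zero w P w' _ hW _ (fun x => x κ * x l) h0' (hS _ _ _ .one .one (.coord2 κ l)))).sub
    (hasSum_termP_left_of_zero w P w' _ (fun a => hL1 a l) _ (fun x => x κ) h0'
      (hS _ _ _ (.coord l) .one (.coord κ)))).sub
    (hasSum_termP_left_of_zero w P w' _ (fun a => hL1 a κ) _ (fun x => x l) h0'
      (hS _ _ _ (.coord κ) .one (.coord l)))).add
    (hasSum_termP_right_of_zero w P w' hP hR0 (fun u => u κ * u l) hrow (hS _ _ _ (.coord2 κ l) .one .one))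
  simp only [add_zero, sub_zero] at h
  rw [show σ * ∑ b : Fin d → Fin N, m₂ (resSite b) * σ' + σ * ∑ b : Fin d → Fin N, m₁ κ (resSite b) * C' l
      + σ * ∑ b : Fin d → Fin N, m₁ l (resSite b) * C' κ - C l * ∑ b : Fin d → Fin N, m₁ κ (resSite b) * σ'
      - C κ * ∑ b : Fin d → Fin N, m₁ l (resSite b) * σ'
      = σ * σ' * ∑ b : Fin d → Fin N, m₂ (resSite b) + (σ * C' l - C l * σ') * ∑ b : Fin d → Fin N, m₁ κ (resSite b)
        + (σ * C' κ - C κ * σ') * ∑ b : Fin d → Fin N, m₁ l (resSite b) by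
    simp only [← Finset.sum_mul]; ring] at h
  exact h

end FiveTerm

/-- [folklore] **THE FIVE-TERM IDENTITY ON THE COARSE LATTICE, every summability discharged** (`0 < N`; `y = N • z`, weight `N² · z_κ z_λ`).
Patterns `w, w'` with absolutely summable second moments reproducing constants and affine functions; block-periodic `P` with absolutely
summable base-point kernels whose COLUMNS and ROWS sum to zero at every point.  With `M₂ := Σ_{classes r} Σ'_t t_κ t_λ P (r+t) r` and
`M₁μ := Σ_{classes r} Σ'_t t_μ P (r+t) r`:
`Σ_z (N² z_κ z_λ) • dressedSumP w P w' (N•z) = σσ'·M₂ + (σ·C'λ − Cλ·σ')·M₁κ + (σ·C'κ − Cκ·σ')·M₁λ`. -/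
theorem decimatedSumP_second_moment_lattice_of_colrow (hN : 0 < N) {w w' : (Fin d → ℤ) → ℝ} {P : Ker₂ d}
    (hP : IsBlockPeriodic N P) (hw : AbsMoment₂ w) (hw' : AbsMoment₂ w') (hPabs : ∀ b, AbsMoment₂ (baseKer P b))
    {σ σ' : ℝ} {C C' : Fin d → ℝ}
    (hL0 : ConstReproSum N w σ) (hL1 : LinReproSum N w C) (hR0 : ConstReproSum N w' σ') (hR1 : LinReproSum N w' C')
    (hcol : ∀ b, HasSum (fun s => P s b) 0) (hrow : ∀ b, HasSum (P b) 0) (κ l : Fin d) :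
    HasSum (fun z : Fin d → ℤ => ((N : ℤ) ^ 2 * (z κ * z l)) • dressedSumP w P w' ((N : ℤ) • z))
      (σ * σ' * ∑ r : Fin d → Fin N, ∑' t, (t κ : ℝ) * (t l : ℝ) * baseKer P (resSite r) t
        + (σ * C' l - C l * σ') * ∑ r : Fin d → Fin N, ∑' t, (t κ : ℝ) * baseKer P (resSite r) t
        + (σ * C' κ - C κ * σ') * ∑ r : Fin d → Fin N, ∑' t, (t l : ℝ) * baseKer P (resSite r) t) := by
  have hF : AbsMoment₂ (periodicMajorant N P) := absMoment₂_periodicMajorant hPabs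
  have hPF : ∀ b t, |P (b + t) b| ≤ periodicMajorant N P t := abs_baseKer_le_periodicMajorant hN hP
  have hS : MonoSummableP N w P w' := monoSummableP_of_majorant hw hF hw' hPF
  have hcol' : ∀ b, HasSum (baseKer P b) 0 := fun b =>
    ((Equiv.hasSum_iff (Equiv.addLeft b)).mpr (hcol b)).congr_fun (fun _ => rfl)
  have A := hasSum_termP_second_of_colrow w P w' hN hP hL0 hL1 hR0 hR1 κ l
    (m₁ := fun μ b => ∑' t, (t μ : ℝ) * baseKer P b t) (m₂ := fun b => ∑' t, (t κ : ℝ) * (t l : ℝ) * baseKer P b t)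
    hcol' hrow (fun b μ => (hasSum_moments_baseKer hPabs b μ l).1) (fun b => (hasSum_moments_baseKer hPabs b κ l).2) hS
  exact (hasSum_latticeP_iff hN.ne' _ κ l _).2
    (hasSum_coarseP w P w' (fun y => y κ * y l) A (summable_dressedP_fibre hw hF hw' hPF))

/-! ## §3 The matrix sandwich with Kronecker masses and Kronecker first moments: the cross term in closed form -/

/-- [folklore] **THE DECIMATED SECOND MOMENT OF AN ENTRY OF THE SANDWICH — KRONECKER COLUMN, CROSS TERM EXPLICIT** (spec normalisation,
`0 < N`).  Response kernel `w` with Kronecker coset masses `δ_{κl}·N^{−(d+1)}` AND KRONECKER FIRST MOMENTS `δ_{κl}·C1 κ` (coset-independent);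
fine kernel entries `P c e` block periodic with absolutely summable base-point kernels, columns and rows summing to zero at every point —
NO first-moment hypothesis on `P`.  Then `z ↦ (N² z_κ z_λ) • K_{ab}(N z)` HAS THE SUM
`N^{−(d+1)} · ( N^{−(d+1)} · M₂[P_{ab}]_{κλ} + (C1 b λ − C1 a λ) · M₁[P_{ab}]_κ + (C1 b κ − C1 a κ) · M₁[P_{ab}]_λ )`
(`M₂`, `M₁` the base-point-summed moments): only the `(a,b)` entry contributes, and its cross terms are DIFFERENCES of the diagonal
first-moment constants — beta-num-g36's CROSS formula under Kronecker `C`, kernel-checked. -/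
theorem secondMoment_dressedEntryP_hasSum_lattice_kronecker (hN : 0 < N) (w : EKer d) (P : EKer₂ d)
    (hP : ∀ c e, IsBlockPeriodic N (P c e))
    (hw0 : ∀ κ l, ConstReproSum N (w κ l) (if κ = l then (((N : ℝ) ^ (d + 1))⁻¹) else 0))
    {C1 : Fin d → Fin d → ℝ} (hw1 : ∀ κ l, LinReproSum N (w κ l) (fun μ => if κ = l then C1 κ μ else 0))
    (hwA : ∀ κ l, AbsMoment₂ (w κ l)) (hPA : ∀ c e b, AbsMoment₂ (baseKer (P c e) b))
    (hcol : ∀ c e b, HasSum (fun s => P c e s b) 0) (hrow : ∀ c e b, HasSum (P c e b) 0) (κ lam a b : Fin d) :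
    HasSum (fun z : Fin d → ℤ => ((N : ℤ) ^ 2 * (z κ * z lam)) • dressedEntryP w P ((N : ℤ) • z) a b)
      ((((N : ℝ) ^ (d + 1))⁻¹) *
        ((((N : ℝ) ^ (d + 1))⁻¹) * ∑ r : Fin d → Fin N, ∑' t, (t κ : ℝ) * (t lam : ℝ) * baseKer (P a b) (resSite r) t
          + (C1 b lam - C1 a lam) * ∑ r : Fin d → Fin N, ∑' t, (t κ : ℝ) * baseKer (P a b) (resSite r) t
          + (C1 b κ - C1 a κ) * ∑ r : Fin d → Fin N, ∑' t, (t lam : ℝ) * baseKer (P a b) (resSite r) t)) := by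
  set s : ℝ := (((N : ℝ) ^ (d + 1))⁻¹) with hs
  -- per entry: the five-term identity with the Kronecker letters of the two patterns
  have hce : ∀ c e : Fin d,
      HasSum (fun z : Fin d → ℤ => ((N : ℤ) ^ 2 * (z κ * z lam)) • dressedSumP (w c a) (P c e) (w e b) ((N : ℤ) • z))
        ((if c = a then s else 0) * (if e = b then s else 0)
            * ∑ r : Fin d → Fin N, ∑' t, (t κ : ℝ) * (t lam : ℝ) * baseKer (P c e) (resSite r) t
          + ((if c = a then s else 0) * (if e = b then C1 e lam else 0) - (if c = a then C1 c lam else 0) * (if e = b then s else 0))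
            * ∑ r : Fin d → Fin N, ∑' t, (t κ : ℝ) * baseKer (P c e) (resSite r) t
          + ((if c = a then s else 0) * (if e = b then C1 e κ else 0) - (if c = a then C1 c κ else 0) * (if e = b then s else 0))
            * ∑ r : Fin d → Fin N, ∑' t, (t lam : ℝ) * baseKer (P c e) (resSite r) t) := by
    intro c e
    exact decimatedSumP_second_moment_lattice_of_colrow hN (hP c e) (hwA c a) (hwA e b) (hPA c e) (hw0 c a) (hw1 c a)
      (hw0 e b) (hw1 e b) (hcol c e) (hrow c e) κ lam
  have hsum := hasSum_sum (s := (Finset.univ : Finset (Fin d)))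
    (fun c _ => hasSum_sum (s := (Finset.univ : Finset (Fin d))) (fun e _ => hce c e))
  -- only the entry `(a, b)` survives
  have hval : ∑ c ∈ (Finset.univ : Finset (Fin d)), ∑ e ∈ (Finset.univ : Finset (Fin d)),
      ((if c = a then s else 0) * (if e = b then s else 0)
            * ∑ r : Fin d → Fin N, ∑' t, (t κ : ℝ) * (t lam : ℝ) * baseKer (P c e) (resSite r) t
          + ((if c = a then s else 0) * (if e = b then C1 e lam else 0) - (if c = a then C1 c lam else 0) * (if e = b then s else 0))
            * ∑ r : Fin d → Fin N, ∑' t, (t κ : ℝ) * baseKer (P c e) (resSite r) t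
          + ((if c = a then s else 0) * (if e = b then C1 e κ else 0) - (if c = a then C1 c κ else 0) * (if e = b then s else 0))
            * ∑ r : Fin d → Fin N, ∑' t, (t lam : ℝ) * baseKer (P c e) (resSite r) t)
      = s * (s * ∑ r : Fin d → Fin N, ∑' t, (t κ : ℝ) * (t lam : ℝ) * baseKer (P a b) (resSite r) t
          + (C1 b lam - C1 a lam) * ∑ r : Fin d → Fin N, ∑' t, (t κ : ℝ) * baseKer (P a b) (resSite r) t
          + (C1 b κ - C1 a κ) * ∑ r : Fin d → Fin N, ∑' t, (t lam : ℝ) * baseKer (P a b) (resSite r) t) := by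
    rw [Finset.sum_eq_single a]
    · rw [Finset.sum_eq_single b]
      · simp only [if_true]
        ring
      · intro e _ hne
        simp only [if_neg hne, mul_zero, zero_mul, sub_zero, add_zero]
      · intro h; exact absurd (Finset.mem_univ b) h
    · intro c _ hne
      refine Finset.sum_eq_zero (fun e _ => ?_)
      simp only [if_neg hne, zero_mul, sub_zero, add_zero]
    · intro h; exact absurd (Finset.mem_univ a) h
  rw [hval] at hsum
  refine hsum.congr_fun (fun z => ?_)
  simp only [dressedEntryP, Finset.smul_sum]

/-! ## §4 The entries `κ, λ ∈ {a, b}`: only the DIAGONAL base-point-summed first moments are consumed -/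

/-- [folklore] Columns from rows for a family symmetric under fibre transposition (`P c e s s' = P e c s' s`). -/
theorem hasSum_col_of_transpose {P : EKer₂ d} (hsymm : ∀ c e s s', P c e s s' = P e c s' s)
    (hrow : ∀ c e b, HasSum (P c e b) 0) (c e : Fin d) (b : Fin d → ℤ) : HasSum (fun s => P c e s b) 0 :=
  (hrow e c b).congr_fun (fun s => hsymm c e s b)

/-- [folklore] **THE SPEC-NORMALISED IDENTITY AT THE ENTRIES `κ, λ ∈ {a, b}` WITHOUT `hT1`** (`0 < N`).  Kronecker masses and Kronecker
first moments of the column; entries `P c e` block periodic, absolutely summable base-point kernels, rows summing to zero pointwise,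
TRANSPOSITION-SYMMETRIC family (`P c e s s' = P e c s' s`), and the DIAGONAL base-point-summed first moments vanishing
(`∀ c e, Σ_{classes r} Σ'_t t_c · P c e (r+t) r = 0` — §5 supplies this from first-bond divergence-freeness): for `κ, λ ∈ {a, b}`,
`z ↦ (N² z_κ z_λ) • K_{ab}(N z)` HAS THE SUM `N^{−(d+2)} · avgM2 N (P a b) κ λ`. -/
theorem secondMoment_dressedEntryP_hasSum_lattice_of_diag (hN : 0 < N) (w : EKer d) (P : EKer₂ d)
    (hP : ∀ c e, IsBlockPeriodic N (P c e)) (hsymm : ∀ c e s s', P c e s s' = P e c s' s)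
    (hw0 : ∀ κ l, ConstReproSum N (w κ l) (if κ = l then (((N : ℝ) ^ (d + 1))⁻¹) else 0))
    {C1 : Fin d → Fin d → ℝ} (hw1 : ∀ κ l, LinReproSum N (w κ l) (fun μ => if κ = l then C1 κ μ else 0))
    (hwA : ∀ κ l, AbsMoment₂ (w κ l)) (hPA : ∀ c e b, AbsMoment₂ (baseKer (P c e) b)) (hrow : ∀ c e b, HasSum (P c e b) 0)
    (hT1d : ∀ c e, ∑ r : Fin d → Fin N, ∑' t, (t c : ℝ) * baseKer (P c e) (resSite r) t = 0)
    {κ lam a b : Fin d} (hκ : κ = a ∨ κ = b) (hlam : lam = a ∨ lam = b) :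
    HasSum (fun z : Fin d → ℤ => ((N : ℤ) ^ 2 * (z κ * z lam)) • dressedEntryP w P ((N : ℤ) • z) a b)
      ((((N : ℝ) ^ (d + 2))⁻¹) * avgM2 N (P a b) κ lam) := by
  have hN' : (N : ℝ) ≠ 0 := by exact_mod_cast hN.ne'
  -- the two first moments of the `(a, b)` entry that the cross term consumes both vanish
  have hzero : ∀ μ : Fin d, (μ = a ∨ μ = b) → ∑ r : Fin d → Fin N, ∑' t, (t μ : ℝ) * baseKer (P a b) (resSite r) t = 0 := by
    rintro μ (rfl | rfl)
    · exact hT1d μ b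
    · rw [sum_firstMoment_baseKer_eq_neg_of_transpose hN (hP μ a) (hsymm a μ)
        (absMoment₂_periodicMajorant (hPA μ a)) (abs_baseKer_le_periodicMajorant hN (hP μ a)) μ, hT1d μ a, neg_zero]
  have h := secondMoment_dressedEntryP_hasSum_lattice_kronecker hN w P hP hw0 hw1 hwA hPA (hasSum_col_of_transpose hsymm hrow) hrow
    κ lam a b
  rw [hzero κ hκ, hzero lam hlam, mul_zero, mul_zero, add_zero, add_zero] at h
  have hval : (((N : ℝ) ^ (d + 1))⁻¹) * ((((N : ℝ) ^ (d + 1))⁻¹)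
      * ∑ r : Fin d → Fin N, ∑' t, (t κ : ℝ) * (t lam : ℝ) * baseKer (P a b) (resSite r) t)
      = (((N : ℝ) ^ (d + 2))⁻¹) * avgM2 N (P a b) κ lam := by
    unfold avgM2
    field_simp
    ring
  rwa [hval] at h

/-- [folklore] **… AND AT A DIAGONAL ENTRY `a = b`, NO FIRST-MOMENT HYPOTHESIS AT ALL**: the cross term of §3 is a difference of the two
diagonal constants of the SAME index. -/
theorem secondMoment_dressedEntryP_hasSum_lattice_of_diag_entry (hN : 0 < N) (w : EKer d) (P : EKer₂ d)
    (hP : ∀ c e, IsBlockPeriodic N (P c e))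
    (hw0 : ∀ κ l, ConstReproSum N (w κ l) (if κ = l then (((N : ℝ) ^ (d + 1))⁻¹) else 0))
    {C1 : Fin d → Fin d → ℝ} (hw1 : ∀ κ l, LinReproSum N (w κ l) (fun μ => if κ = l then C1 κ μ else 0))
    (hwA : ∀ κ l, AbsMoment₂ (w κ l)) (hPA : ∀ c e b, AbsMoment₂ (baseKer (P c e) b))
    (hcol : ∀ c e b, HasSum (fun s => P c e s b) 0) (hrow : ∀ c e b, HasSum (P c e b) 0) (κ lam a : Fin d) :
    HasSum (fun z : Fin d → ℤ => ((N : ℤ) ^ 2 * (z κ * z lam)) • dressedEntryP w P ((N : ℤ) • z) a a)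
      ((((N : ℝ) ^ (d + 2))⁻¹) * avgM2 N (P a a) κ lam) := by
  have hN' : (N : ℝ) ≠ 0 := by exact_mod_cast hN.ne'
  have h := secondMoment_dressedEntryP_hasSum_lattice_kronecker hN w P hP hw0 hw1 hwA hPA hcol hrow κ lam a a
  rw [sub_self, sub_self, zero_mul, zero_mul, add_zero, add_zero] at h
  have hval : (((N : ℝ) ^ (d + 1))⁻¹) * ((((N : ℝ) ^ (d + 1))⁻¹)
      * ∑ r : Fin d → Fin N, ∑' t, (t κ : ℝ) * (t lam : ℝ) * baseKer (P a a) (resSite r) t)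
      = (((N : ℝ) ^ (d + 2))⁻¹) * avgM2 N (P a a) κ lam := by
    unfold avgM2
    field_simp
    ring
  rwa [hval] at h

/-- [folklore] **BOND NORMALISATION, `d = 4`, ENTRIES `κ, λ ∈ {a, b}`** — `HasSum` form: the coarse bond second moment of the `(a,b)` entry of
the sandwich EQUALS the base-point average of the fine second moment (cf. `MomentTransferPeriodicEntry.bondSecondMomentP_hasSum_four`, whose
`hT1` is replaced by its diagonal part + transposition symmetry, and whose `hcol` follows from `hrow`). -/
theorem bondSecondMomentP_hasSum_four_of_diag (hN : 0 < N) (w : EKer 4) (P : EKer₂ 4)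
    (hP : ∀ c e, IsBlockPeriodic N (P c e)) (hsymm : ∀ c e s s', P c e s s' = P e c s' s)
    (hw0 : ∀ κ l, ConstReproSum N (w κ l) (if κ = l then (((N : ℝ) ^ (4 + 1))⁻¹) else 0))
    {C1 : Fin 4 → Fin 4 → ℝ} (hw1 : ∀ κ l, LinReproSum N (w κ l) (fun μ => if κ = l then C1 κ μ else 0))
    (hwA : ∀ κ l, AbsMoment₂ (w κ l)) (hPA : ∀ c e b, AbsMoment₂ (baseKer (P c e) b)) (hrow : ∀ c e b, HasSum (P c e b) 0)
    (hT1d : ∀ c e, ∑ r : Fin 4 → Fin N, ∑' t, (t c : ℝ) * baseKer (P c e) (resSite r) t = 0)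
    {κ lam a b : Fin 4} (hκ : κ = a ∨ κ = b) (hlam : lam = a ∨ lam = b) :
    HasSum (fun z : Fin 4 → ℤ => ((z κ * z lam : ℤ) : ℝ) * ((N : ℝ) ^ 8 * dressedEntryP w P ((N : ℤ) • z) a b))
      (avgM2 N (P a b) κ lam) := by
  have hN' : (N : ℝ) ≠ 0 := by exact_mod_cast hN.ne'
  have h := (secondMoment_dressedEntryP_hasSum_lattice_of_diag hN w P hP hsymm hw0 hw1 hwA hPA hrow hT1d hκ hlam).mul_left
    ((N : ℝ) ^ 8 / (N : ℝ) ^ 2)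
  have hval : (N : ℝ) ^ 8 / (N : ℝ) ^ 2 * ((((N : ℝ) ^ (4 + 2))⁻¹) * avgM2 N (P a b) κ lam) = avgM2 N (P a b) κ lam := by
    field_simp
  rw [hval] at h
  refine h.congr_fun (fun z => ?_)
  simp only [zsmul_eq_mul, Int.cast_mul, Int.cast_pow, Int.cast_natCast]
  field_simp

/-- [folklore] **`d = 4`, ENTRIES `κ, λ ∈ {a, b}`: THE COARSE BOND SECOND MOMENT OF THE SANDWICH EQUALS THE BASE-POINT AVERAGE OF THE FINE SECOND
MOMENT — WITHOUT `hT1`** (`tsum` form).  Hypotheses on `P`: periodicity, transposition symmetry, row sums zero pointwise, summability, and the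
DIAGONAL base-point-summed first moments zero; on `w`: Kronecker masses AND Kronecker first moments.  In particular at `(κ, λ) = (a, b)` —
`B12Beta.secondMoment`'s shape. -/
theorem bondSecondMomentP_tsum_four_of_diag (hN : 0 < N) (w : EKer 4) (P : EKer₂ 4)
    (hP : ∀ c e, IsBlockPeriodic N (P c e)) (hsymm : ∀ c e s s', P c e s s' = P e c s' s)
    (hw0 : ∀ κ l, ConstReproSum N (w κ l) (if κ = l then (((N : ℝ) ^ (4 + 1))⁻¹) else 0))
    {C1 : Fin 4 → Fin 4 → ℝ} (hw1 : ∀ κ l, LinReproSum N (w κ l) (fun μ => if κ = l then C1 κ μ else 0))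
    (hwA : ∀ κ l, AbsMoment₂ (w κ l)) (hPA : ∀ c e b, AbsMoment₂ (baseKer (P c e) b)) (hrow : ∀ c e b, HasSum (P c e b) 0)
    (hT1d : ∀ c e, ∑ r : Fin 4 → Fin N, ∑' t, (t c : ℝ) * baseKer (P c e) (resSite r) t = 0)
    {κ lam a b : Fin 4} (hκ : κ = a ∨ κ = b) (hlam : lam = a ∨ lam = b) :
    ∑' z : Fin 4 → ℤ, ((z κ * z lam : ℤ) : ℝ) * ((N : ℝ) ^ 8 * dressedEntryP w P ((N : ℤ) • z) a b)
      = avgM2 N (P a b) κ lam :=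
  (bondSecondMomentP_hasSum_four_of_diag hN w P hP hsymm hw0 hw1 hwA hPA hrow hT1d hκ hlam).tsum_eq

/-- [folklore] **`d = 4`, DIAGONAL ENTRY `a = b`, ANY `κ, λ` — NO FIRST-MOMENT HYPOTHESIS** (`tsum` form). -/
theorem bondSecondMomentP_tsum_four_of_diag_entry (hN : 0 < N) (w : EKer 4) (P : EKer₂ 4)
    (hP : ∀ c e, IsBlockPeriodic N (P c e))
    (hw0 : ∀ κ l, ConstReproSum N (w κ l) (if κ = l then (((N : ℝ) ^ (4 + 1))⁻¹) else 0))
    {C1 : Fin 4 → Fin 4 → ℝ} (hw1 : ∀ κ l, LinReproSum N (w κ l) (fun μ => if κ = l then C1 κ μ else 0))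
    (hwA : ∀ κ l, AbsMoment₂ (w κ l)) (hPA : ∀ c e b, AbsMoment₂ (baseKer (P c e) b))
    (hcol : ∀ c e b, HasSum (fun s => P c e s b) 0) (hrow : ∀ c e b, HasSum (P c e b) 0) (κ lam a : Fin 4) :
    ∑' z : Fin 4 → ℤ, ((z κ * z lam : ℤ) : ℝ) * ((N : ℝ) ^ 8 * dressedEntryP w P ((N : ℤ) • z) a a)
      = avgM2 N (P a a) κ lam := by
  have hN' : (N : ℝ) ≠ 0 := by exact_mod_cast hN.ne'
  have h := (secondMoment_dressedEntryP_hasSum_lattice_of_diag_entry hN w P hP hw0 hw1 hwA hPA hcol hrow κ lam a).mul_left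
    ((N : ℝ) ^ 8 / (N : ℝ) ^ 2)
  have hval : (N : ℝ) ^ 8 / (N : ℝ) ^ 2 * ((((N : ℝ) ^ (4 + 2))⁻¹) * avgM2 N (P a a) κ lam) = avgM2 N (P a a) κ lam := by
    field_simp
  rw [hval] at h
  refine (h.congr_fun (fun z => ?_)).tsum_eq
  simp only [zsmul_eq_mul, Int.cast_mul, Int.cast_pow, Int.cast_natCast]
  field_simp

end Summit.QuantumFields.BalabanUV.Beta.D1BFx.MomentTransferKronecker
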